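import Summits.KontsevichZagierPeriods.KontsevichZagierPeriods.Theorems.LinRedNormalFormArrangementNormalFormStubRebaseSimplePosManyFibre

/-!
# Stub `stub_rebaseSimplePosMany`, part `rebaseSimplePosMany_product` (crux `ArrangementNormalForm`, line `janus-bands`) — `Generic`

Product fibres IN GENERAL POSITION over a base of dimension `B + 1` are good — UNCONDITIONALLY.
A fibre datum (letter `c`, affine bounds `u < v`) is in general position over the closed base cell
`{rows ≥ 0}` (`RebaseMany.Generic`) if at every point of the closed cell where the fibre pinches
(`u = v`) the bounds are non-parallel in `y` and the pinch is OFF the letter (`u ≠ c`); letter-free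
fibres and fibres with a bound parallel in `y` to the letter are unconstrained (they are terminal).
Tracing the case tree of parts `Fibre` / `Corner` (shear of the letter to `0`, sign cuts, reflection)
shows that the residual configurations (`RebaseMany.IsResidual`: pinched parallel band, corner band
with the apex ON the letter) contradict general position, so the local residual handler
`RebaseMany.HRl` is supplied by contradiction (`RebaseMany.hRl_of_generic`). General position is
inherited by sub-cells — closed cells shrink with open cells as long as the open sub-cell is
non-empty (`RebaseMany.rows_le_of_cell_subset`, a segment argument), and empty sub-cells carry
null representations — so the fibre-by-fibre induction with the restricted continuation hypothesis
`HPc` closes: `RebaseMany.good_isProd_generic`. The residue of the product case of the stub is thus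
EXACTLY the fibres whose apex touches their letter (non-parallel bounds) or which pinch (parallel
bounds) at a point of the closed base cell, in the presence of spectators. Registered:
`rebaseSimplePosMany_isProd_generic`.

References: M. Kontsevich, D. Zagier, *Periods* (2001), §1.2.
-/

noncomputable section

open Set MeasureTheory MvPolynomial
open Literature.NumberTheory.Transcendental Literature.ModelTheory.ExponentialFields

namespace Summit.KontsevichZagierPeriods.ArrangementNormalForm.JanusBands

namespace RebaseMany

open SeparatePos RebasePos

variable {B K : ℕ}

/-! ### Closed cells shrink with non-empty open cells -/

/-- Atoms are affine along segments. [folklore] -/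
theorem affF_segment (d : Cf B) (z z₀ : Fin (B + 1 + K) → ℝ) (t : ℝ) :
    affF B K d (z + t • (z₀ - z)) = affF B K d z + t * (affF B K d z₀ - affF B K d z) := by
  simp only [affF, Pi.add_apply, Pi.smul_apply, Pi.sub_apply, smul_eq_mul]
  have key : ∀ j : Fin (B + 1), (d.1 j : ℝ) * (z (Fin.castAdd K j) + t * (z₀ (Fin.castAdd K j) - z (Fin.castAdd K j))) =
      (d.1 j : ℝ) * z (Fin.castAdd K j) + t * ((d.1 j : ℝ) * z₀ (Fin.castAdd K j) - (d.1 j : ℝ) * z (Fin.castAdd K j)) :=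
    fun j => by ring
  simp only [key, Finset.sum_add_distrib, ← Finset.mul_sum, Finset.sum_sub_distrib]
  ring

/-- If `x + t y ≥ 0` for all `t ∈ (0, 1]` then `x ≥ 0`. [folklore] -/
theorem nonneg_of_forall_nonneg {x y : ℝ} (h : ∀ t : ℝ, 0 < t → t ≤ 1 → 0 ≤ x + t * y) : 0 ≤ x := by
  by_contra hx
  push Not at hx
  by_cases hy : y ≤ 0
  · have h1 := h 1 one_pos le_rfl
    nlinarith
  · push Not at hy
    set t := min 1 (-x / (2 * y)) with ht
    have ht0 : 0 < t := lt_min one_pos (div_pos (by linarith) (by linarith))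
    have ht1 : t ≤ 1 := min_le_left _ _
    have hty : t * y ≤ -x / 2 := by
      have h2 : t ≤ -x / (2 * y) := min_le_right _ _
      calc t * y ≤ (-x / (2 * y)) * y := mul_le_mul_of_nonneg_right h2 hy.le
        _ = -x / 2 := by field_simp
    linarith [h t ht0 ht1]

/-- **Closed cells shrink with non-empty open cells**: if `cell K M' ⊆ cell K M` and `cell K M'`
is non-empty, the closed cell `{rows M' ≥ 0}` lies in `{rows M ≥ 0}` (segment to an interior
point). [folklore] -/
theorem rows_le_of_cell_subset {m' m'' : ℕ} {M : Fin m' → Cf B} {M' : Fin m'' → Cf B}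
    (hsub : cell K M' ⊆ cell K M) (hne : (cell K M').Nonempty) {z : Fin (B + 1 + K) → ℝ}
    (hz : ∀ j, 0 ≤ affF B K (M' j) z) : ∀ j, 0 ≤ affF B K (M j) z := by
  obtain ⟨z₀, hz₀⟩ := hne
  intro j
  refine nonneg_of_forall_nonneg (y := affF B K (M j) z₀ - affF B K (M j) z) fun t ht0 ht1 => ?_
  have hzt : z + t • (z₀ - z) ∈ cell K M' := (mem_cell M' _).2 fun j' => by
    rw [affF_segment]
    nlinarith [hz j', (mem_cell M' z₀).1 hz₀ j']
  have h1 := (mem_cell M _).1 (hsub hzt) j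
  rw [affF_segment] at h1
  exact h1.le

/-! ### General position -/

/-- A fibre datum `(a, u, v)` is in GENERAL POSITION over the closed cell `{rows M ≥ 0}`: if it is
lettered with both bounds transverse in `y` to the letter `c`, then at every point of the closed
cell where the fibre pinches (`u = v`) the bounds are non-parallel in `y` and the pinch is off the
letter (`u ≠ c`). [folklore] -/
def Generic (K : ℕ) {m' : ℕ} (M : Fin m' → Cf B) (a : Option (Cf B)) (u v : Cf B) : Prop :=
  ∀ c, a = some c → u.1 (Fin.last B) ≠ c.1 (Fin.last B) → v.1 (Fin.last B) ≠ c.1 (Fin.last B) →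
    ∀ z : Fin (B + 1 + K) → ℝ, (∀ j, 0 ≤ affF B K (M j) z) → affF B K u z = affF B K v z →
      u.1 (Fin.last B) ≠ v.1 (Fin.last B) ∧ affF B K u z ≠ affF B K c z

/-- General position is inherited by smaller closed cells. [folklore] -/
theorem Generic.mono_rows {m' m'' : ℕ} {M : Fin m' → Cf B} {M' : Fin m'' → Cf B} {a : Option (Cf B)}
    {u v : Cf B} (hg : Generic K M a u v)
    (hMM' : ∀ z : Fin (B + 1 + K) → ℝ, (∀ j, 0 ≤ affF B K (M' j) z) → ∀ j, 0 ≤ affF B K (M j) z) :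
    Generic K M' a u v :=
  fun c hc hu hv z hz huv => hg c hc hu hv z (hMM' z hz) huv

/-- General position is inherited by non-empty sub-cells. [folklore] -/
theorem Generic.mono {m' m'' : ℕ} {M : Fin m' → Cf B} {M' : Fin m'' → Cf B} {a : Option (Cf B)}
    {u v : Cf B} (hg : Generic K M a u v) (hsub : cell K M' ⊆ cell K M) (hne : (cell K M').Nonempty) :
    Generic K M' a u v :=
  hg.mono_rows fun _ hz => rows_le_of_cell_subset hsub hne hz

section Generic

variable {s : KZ.IntegralRep (B + 1 + K)} {m' : ℕ} {M : Fin m' → Cf B} {U V : Fin K → Cf B}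
  {T : BData B} {p : MvPolynomial (Fin B) ℚ} {a : Fin K → Option (Cf B)}

/-- **The local residual handler by contradiction**: if at every pinch point of the closed cell the
(letter-`0`) bounds of the fibre `i` are non-parallel and do not vanish, no residual configuration
occurs over closed sub-cells. [folklore] -/
theorem hRl_of_generic (i : Fin K)
    (hg : ∀ z : Fin (B + 1 + K) → ℝ, (∀ j, 0 ≤ affF B K (M j) z) → affF B K (U i) z = affF B K (V i) z →
      (U i).1 (Fin.last B) ≠ (V i).1 (Fin.last B) ∧ affF B K (U i) z ≠ 0) :
    HRl T i M U V p a := fun _ _ _ _ hrows _ hres => by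
  exfalso
  rcases hres with ⟨-, hpar, -, z, hz, -, huv⟩ | ⟨κ, A, -, -, -, ⟨z, hz, -, hu0, hv0⟩, -⟩
  · exact (hg z (hrows z hz) huv).1 hpar
  · exact (hg z (hrows z hz) (hu0.trans hv0.symm)).2 hu0

/-- **Letter `0`, transverse bounds in general position: dissection by the signs of the bounds**
(as `good_letterZero`, the residual handler supplied by contradiction). -/
theorem good_letterZero_generic (h : IsProd s M U V T p a) (i : Fin K) (ha : a i = some 0)
    (hP : HPc T i M U V a) (hu : (U i).1 (Fin.last B) ≠ 0) (hv : (V i).1 (Fin.last B) ≠ 0)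
    (huv : ∀ z ∈ cell K M, affF B K (U i) z < affF B K (V i) z)
    (hg : ∀ z : Fin (B + 1 + K) → ℝ, (∀ j, 0 ≤ affF B K (M j) z) → affF B K (U i) z = affF B K (V i) z →
      (U i).1 (Fin.last B) ≠ (V i).1 (Fin.last B) ∧ affF B K (U i) z ≠ 0) :
    Good B K (KZ.of s) := by
  refine rowSplit h (U i) (ne_zero_of_last hu) (fun s₁ h₁ => ?_) (fun s₂ h₂ => ?_)
  · -- above the letter
    exact good_above h₁ i ha (hP.mono (cell_snoc_subset M _))
      (hRl_of_generic i fun z hz huv' => hg z (rows_le_of_snoc M _ hz) huv') hu hv fun z hz => by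
        obtain ⟨hz', hu0⟩ := (mem_cell_snoc _ _ z).1 hz
        exact ⟨hu0, huv z hz'⟩
  · have hsub₂ : cell K (Fin.snoc M (-U i) : Fin (m' + 1) → Cf B) ⊆ cell K M := cell_snoc_subset M _
    refine rowSplit h₂ (V i) (ne_zero_of_last hv) (fun s₃ h₃ => ?_) (fun s₄ h₄ => ?_)
    · -- crossing the letter: split at the level `0`
      refine good_levelCut h₃ i ((hP.mono hsub₂).mono (cell_snoc_subset _ _)) 0
        (yfree_of_letter_zero i ha 0 rfl) fun z hz => ?_
      obtain ⟨hz', hv0⟩ := (mem_cell_snoc _ _ z).1 hz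
      obtain ⟨-, hu0⟩ := (mem_cell_snoc _ _ z).1 hz'
      rw [affF_neg] at hu0
      rw [affF_zero]
      exact ⟨by linarith, hv0.le⟩
    · -- below the letter: reflect
      obtain ⟨s', h', hrel⟩ := reflect h₄ i
      have hsub : cell K (Fin.snoc (Fin.snoc M (-U i) : Fin (m' + 1) → Cf B) (-V i) : Fin (m' + 1 + 1) → Cf B) ⊆
          cell K M := (cell_snoc_subset _ _).trans hsub₂
      have ha' : Function.update a i ((a i).map Neg.neg) i = some 0 := by
        rw [Function.update_self, ha, map_neg_some_zero]
      refine good_of_sub_mem hrel (good_above h' i ha' ((hP.mono hsub).transfer (same_update i U V a _ _ _))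
        (hRl_of_generic i fun z hz huv' => ?_) ?_ ?_ fun z hz => ?_)
      · rw [Function.update_self, Function.update_self, affF_neg, affF_neg, neg_inj] at huv'
        rw [Function.update_self, Function.update_self, neg_fst_last, neg_fst_last, affF_neg]
        obtain ⟨h1, h2⟩ := hg z (rows_le_of_snoc M _ (rows_le_of_snoc _ _ hz)) huv'.symm
        exact ⟨fun he => h1 (neg_inj.1 he).symm, by rw [huv']; exact neg_ne_zero.2 h2⟩
      · rw [Function.update_self, neg_fst_last]; exact neg_ne_zero.2 hv
      · rw [Function.update_self, neg_fst_last]; exact neg_ne_zero.2 hu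
      · obtain ⟨hz', hv0⟩ := (mem_cell_snoc _ _ z).1 hz
        obtain ⟨hz'', -⟩ := (mem_cell_snoc _ _ z).1 hz'
        rw [affF_neg] at hv0
        rw [Function.update_self, Function.update_self, affF_neg, affF_neg]
        exact ⟨by linarith, by linarith [huv z hz'']⟩

/-- **A lettered fibre in general position is good** (given `HPc` only): a bound parallel in `y`
to the letter is terminal; otherwise record the row `v − u > 0`, shear the letter to `0` (general
position passes to the sheared bounds `u − c`, `v − c`) and dissect. -/
theorem good_lettered_generic (h : IsProd s M U V T p a) (i : Fin K) (c : Cf B) (ha : a i = some c)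
    (hP : HPc T i M U V a) (hg : Generic K M (a i) (U i) (V i)) : Good B K (KZ.of s) := by
  by_cases hU : (U i).1 (Fin.last B) = c.1 (Fin.last B)
  · exact good_terminal h i hP fun c' hc' => Or.inl (by rw [ha] at hc'; cases hc'; exact hU)
  by_cases hV : (V i).1 (Fin.last B) = c.1 (Fin.last B)
  · exact good_terminal h i hP fun c' hc' => Or.inr (by rw [ha] at hc'; cases hc'; exact hV)
  have h' := h.addRow i
  have hsub : cell K (Fin.snoc M (V i - U i) : Fin (m' + 1) → Cf B) ⊆ cell K M := cell_snoc_subset M _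
  obtain ⟨s', hs', hrel⟩ := shear h' i c ha
  refine good_of_sub_mem hrel (good_letterZero_generic hs' i (by rw [Function.update_self])
    ((hP.mono hsub).transfer (same_update i U V a _ _ _)) ?_ ?_ (fun z hz => ?_) fun z hz huv => ?_)
  · rw [Function.update_self, pullC_shear_fst_last]; exact sub_ne_zero.2 hU
  · rw [Function.update_self, pullC_shear_fst_last]; exact sub_ne_zero.2 hV
  · rw [Function.update_self, Function.update_self, affF_pullC_shear, affF_pullC_shear]
    have h2 := ((mem_cell_snoc M _ z).1 hz).2
    rw [affF_sub] at h2
    linarith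
  · rw [Function.update_self, Function.update_self, affF_pullC_shear, affF_pullC_shear] at huv
    rw [Function.update_self, Function.update_self, pullC_shear_fst_last, pullC_shear_fst_last,
      affF_pullC_shear]
    obtain ⟨h1, h2⟩ := hg c ha hU hV z (rows_le_of_snoc M _ hz) (by linarith)
    exact ⟨fun he => h1 (by linarith), sub_ne_zero.2 h2⟩

/-- **A fibre in general position is good**, given the restricted continuation hypothesis only:
letter-free fibres are terminal, lettered ones `good_lettered_generic`. -/
theorem good_fibre_generic (h : IsProd s M U V T p a) (i : Fin K) (hP : HPc T i M U V a)
    (hg : Generic K M (a i) (U i) (V i)) : Good B K (KZ.of s) := by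
  rcases ha : a i with _ | c
  · exact good_terminal h i hP fun c hc => by rw [ha] at hc; exact absurd hc (Option.some_ne_none c).symm
  · exact good_lettered_generic h i c ha hP (ha ▸ hg)

end Generic

/-- **The fibre-by-fibre induction in general position** (no oracle): the invariant "every
unformatted fibre is in general position over the current closed cell" passes to non-empty
sub-cells, and representations over empty sub-cells are null. [folklore] -/
theorem good_of_card_le_generic (T : BData B) (n : ℕ) : ∀ {m' : ℕ} (s : KZ.IntegralRep (B + 1 + K))
    (M : Fin m' → Cf B) (U V : Fin K → Cf B) (p : MvPolynomial (Fin B) ℚ) (a : Fin K → Option (Cf B)),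
    IsProd s M U V T p a → ∀ S : Finset (Fin K), S.card ≤ n →
    (∀ j, j ∉ S → InFmt (a j) (U j) (V j)) → (∀ j, j ∈ S → Generic K M (a j) (U j) (V j)) →
    Good B K (KZ.of s) := by
  induction n with
  | zero =>
    intro m' s M U V p a h S hS hf _
    have hS' : S = ∅ := Finset.card_eq_zero.1 (Nat.le_zero.1 hS)
    exact good_of_allFmt h fun j => hf j (by simp [hS'])
  | succ n ih =>
    intro m' s M U V p a h S hS hf hg
    by_cases hall : ∀ j ∈ S, InFmt (a j) (U j) (V j)
    · refine good_of_allFmt h fun j => ?_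
      by_cases hj : j ∈ S
      · exact hall j hj
      · exact hf j hj
    push Not at hall
    obtain ⟨i, hi, -⟩ := hall
    have hP : HPc T i M U V a := fun m'' s' M' U' V' p' a' h' hM' hfi hs => by
      rcases (cell K M').eq_empty_or_nonempty with hemp | hne
      · exact good_of_cell_empty h' hemp
      refine ih s' M' U' V' p' a' h' (S.erase i) (by rw [Finset.card_erase_of_mem hi]; omega)
        (fun j hj => ?_) fun j hj => ?_
      · by_cases hji : j = i
        · subst hji; exact hfi
        · obtain ⟨h1, h2, h3⟩ := hs j hji
          rw [h1, h2, h3]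
          exact hf j fun hjS => hj (Finset.mem_erase.2 ⟨hji, hjS⟩)
      · obtain ⟨hji, hjS⟩ := Finset.mem_erase.1 hj
        obtain ⟨h1, h2, h3⟩ := hs j hji
        rw [h1, h2, h3]
        exact (hg j hjS).mono hM' hne
    exact good_fibre_generic h i hP (hg i hi)

/-- **Every product representation all of whose fibres are in general position over the closed base
cell is good** (unconditionally). [folklore] -/
theorem good_isProd_generic {s : KZ.IntegralRep (B + 1 + K)} {m' : ℕ} {M : Fin m' → Cf B}
    {U V : Fin K → Cf B} {T : BData B} {p : MvPolynomial (Fin B) ℚ} {a : Fin K → Option (Cf B)}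
    (h : IsProd s M U V T p a) (hg : ∀ j, Generic K M (a j) (U j) (V j)) : Good B K (KZ.of s) :=
  good_of_card_le_generic T K s M U V p a h Finset.univ (by simp)
    (fun j hj => absurd (Finset.mem_univ j) hj) fun j _ => hg j

/-- Tame fibres are in general position (thick bands do not pinch on the closed cell of a
non-empty open cell; terminal fibres are unconstrained) — so `good_isProd_tame` is also an instance
of `good_isProd_generic` over non-empty cells. [folklore] -/
theorem Tame.generic {m' : ℕ} {M : Fin m' → Cf B} {a : Option (Cf B)} {u v : Cf B}
    (ht : Tame K M a u v) (hne : (cell K M).Nonempty) : Generic K M a u v := by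
  intro c hc hu hv z hz huv
  rcases ht with ht | ⟨c₀, hc₀, hth⟩
  · exact absurd (ht c hc) (not_or.2 ⟨hu, hv⟩)
  · exfalso
    -- thickness extends to the closed cell along a segment to an interior point
    obtain ⟨z₀, hz₀⟩ := hne
    have key : 0 ≤ affF B K v z - affF B K u z - c₀ := by
      refine nonneg_of_forall_nonneg
        (y := (affF B K v z₀ - affF B K u z₀) - (affF B K v z - affF B K u z)) fun t ht0 ht1 => ?_
      have hzt : z + t • (z₀ - z) ∈ cell K M := (mem_cell M _).2 fun j' => by
        rw [affF_segment]
        nlinarith [hz j', (mem_cell M z₀).1 hz₀ j']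
      have h1 := hth _ hzt
      rw [affF_segment, affF_segment] at h1
      linarith
    linarith

end RebaseMany

/-- Registered support goal of this file: a product representation over a base of dimension
`B + 1` all of whose fibres are in general position over the closed base cell (every pinch point
`Uᵢ = Vᵢ` of a lettered fibre with transverse bounds has non-parallel bounds and lies off the
letter) is congruent modulo `KZ.relations` to the subgroup generated by the literal rebased class
`GG B 2 K` — unconditionally (`RebaseMany.good_isProd_generic`). -/
theorem rebaseSimplePosMany_isProd_generic (B K m' : ℕ) (s : KZ.IntegralRep (B + 1 + K)) (M : Fin m' → (Fin (B + 1) → ℚ) × ℚ) (U V : Fin K → (Fin (B + 1) → ℚ) × ℚ) (T : RebaseMany.BData B) (p : MvPolynomial (Fin B) ℚ) (a : Fin K → Option ((Fin (B + 1) → ℚ) × ℚ)) (h : RebaseMany.IsProd s M U V T p a) (hg : ∀ j, RebaseMany.Generic K M (a j) (U j) (V j)) : ∃ c ∈ AddSubgroup.closure (SeparatePos.GGset B 2 K), KZ.of s - c ∈ KZ.relations :=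
  RebaseMany.good_isProd_generic h hg

end Summit.KontsevichZagierPeriods.ArrangementNormalForm.JanusBands
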